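import Summits.AtomisticToContinuum.Crystallization.Theorems.FrustratedLawDichotomyStrainedPatchCoreTubeRecord

/-!
# «CoreTube», milli variant: the record node at core radius `111/20` (lens-5 g47 second addendum; §5 of the node, a separate file so that the verified
# files of record `…StrainedPatchCoreTube` (§1–§2) and `…StrainedPatchCoreTubeRecord` (§3–§4) land unchanged)

At `ρ = 24/5` the CoreTube seam `φ + A + μ ≤ m` is spent exactly at `m = 1/625` (`seam_arith_core`, critic ROW 841 (2)) and is INFEASIBLE at `m = 1/1000`
(`μ = 1/1000` alone eats it).  Moving the core radius out to `111/20` kills the far tail (only the far end of `W₄₅` acts between `111/20` and `63/10`: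
on file the signed tail is `∈ [−2.8e-5, −1.4e-5]` over 86 states, `g47/out/DIALTABLE.txt`), so `μ = 1/10000`, `A = 3/5000` and the seam closes at
`m = 1/1000` with slack `3/10000` — the (H) literal at which hand-1 g21's SCALING MEMO counts ≈ 90× fewer certificate leaves and for which
`…HomEntrySix.homFloor_milli_of_entrySearches6` / `…HomEntrySixHcp.homFloor_milli_of_entrySearches66` are already in the tree.  This is the re-thread
critic ROW 844 anticipates («IF the count says (H) feasible only at 1/1000 ⇒ lens-5 re-threads the record»), offered IN ADVANCE of the count; the
24/5 record node is untouched and remains the node of record until crit-1 rules.  Price: the residual `CoreOffTubeFloor (63/10) (63/10) (111/20) (1/100) (1/1000)`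
is formally STRONGER than the 24/5 one (it implies it: `coreOff_record_of_coreOff_555`); on file the class census at `ε = 1/100` is identical (24 core-tube /
2 core-far).  No sorry, no new axioms, no cite tokens, no instances / notation.  Evidence: `run/shared/lean/pub/decomp-a2c/decomp-a2c-lens-5/g47/`.
-/

namespace Summit.AtomisticToContinuum.Crystallization.Theorems.FrustratedLawDichotomyStrainedPatchCoreTubeMilli

open scoped BigOperators Classical
open scoped BigOperators Classical
open Literature.MathematicalPhysics.StatisticalMechanics (lennardJones lennardJones_nonpos)
open Summit.AtomisticToContinuum.Crystallization.Theorems.FrustratedLawDichotomyRangeCut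
open Summit.AtomisticToContinuum.Crystallization.Theorems.FrustratedLawDichotomySchurCut
open Summit.AtomisticToContinuum.Crystallization.Theorems.FrustratedLawDichotomyMotifLemmas
open Summit.AtomisticToContinuum.Crystallization.Theorems.FrustratedLawDichotomyAveragingCut
open Summit.AtomisticToContinuum.Crystallization.Theorems.FrustratedLawDichotomyAveragingRuleCap
open Summit.AtomisticToContinuum.Crystallization.Theorems.FrustratedLawDichotomyAveragingRuleTightFree
open Summit.AtomisticToContinuum.Crystallization.Theorems.FrustratedLawDichotomyRuleToolkitGood (goodFlag)
open Summit.AtomisticToContinuum.Crystallization.Theorems.FrustratedLawDichotomyExemptDoor (SitePred)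
open Summit.AtomisticToContinuum.Crystallization.Theorems.FrustratedLawDichotomyExemptAbsorption
open Summit.AtomisticToContinuum.Crystallization.Theorems.FrustratedLawDichotomyExemptAbsorptionRecord
open Summit.AtomisticToContinuum.Crystallization.Theorems.FrustratedLawDichotomyCollarCensus
open Summit.AtomisticToContinuum.Crystallization.Theorems.FrustratedLawDichotomyCollarCensusKappa
open Summit.AtomisticToContinuum.Crystallization.Theorems.FrustratedLawDichotomyStrainedPatchHomSplit
open Summit.AtomisticToContinuum.Crystallization.Theorems.FrustratedLawDichotomyStrainedPatchCleanCollar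
open Summit.AtomisticToContinuum.Crystallization.Theorems.FrustratedLawDichotomyStrainedPatchHomTube
open Summit.AtomisticToContinuum.Crystallization.Theorems.FrustratedLawDichotomyStrainedPatchHomIsometry
open Summit.AtomisticToContinuum.Crystallization.Theorems.FrustratedLawDichotomyStrainedPatchHomTubeIso
open Summit.AtomisticToContinuum.Crystallization.Theorems.FrustratedLawDichotomyStrainedPatchPhaseCut
open Summit.AtomisticToContinuum.Crystallization.Theorems.FrustratedLawDichotomyStrainedPatchCoreTube
open Summit.AtomisticToContinuum.Crystallization.Theorems.FrustratedLawDichotomyStrainedPatchCoreTubeRecord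

/-! ## §5 (of the node «CoreTube»). The node at core radius `111/20`: the far tail all but vanishes there, which frees (H) to `m = 1/1000`
At `ρ = 111/20` every partner of a member beyond `ρ` lies in `(111/20, 63/10]`, where only the far end of `W₄₅` acts: on file the signed tail is
`∈ [−2.8e-5, −1.4e-5]` (86 states; `g47/out/DIALTABLE.txt`) against `[−7.1e-4, −4.9e-4]` at `24/5`, so the tail literal drops to `μ = 1/10000` (3.6×
margin) while the core relief stays `A = 3/5000` (worst on file `2.56e-4`) and the class census at `ε = 1/100` is unchanged (24 core-tube / 2 core-far =
the torsion textures, whose lower fit bounds only grow with the radius).  The seam `A + μ ≤ m` then holds at `m = 1/1000` with slack `3/10000` — the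
literal at which (H) costs ≈ 90× fewer certificate leaves (hand-1 g21 SCALING MEMO; `…HomCollar.seam_arith_milli`).  Price: the residual
`CoreOffTubeFloor … (111/20) …` is STRONGER than at `24/5` (`CoreOffTubeFloor.of_le_core`: fewer clusters are `111/20`-near, so more are far). -/

/-- Arithmetic of the milli variant: `A + μ = 3/5000 + 1/10000 ≤ 1/1000 = m` (slack `3/10000`). [formal bookkeeping] -/
theorem seam_arith_core_milli : (3 : ℝ) / 5000 + 1 / 10000 ≤ 1 / 1000 := by norm_num

/-- ★★ RECORD NODE, MILLI VARIANT (`ρ = 111/20`, `ε = 1/100`, `m = 1/1000`, `μ = 1/10000`, `A = 3/5000`; residual / phase floors `1/1000` PROVISIONAL):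
`HomFloor (1/1000) → TailPenalty (111/20) (1/10000) → CoreCoreRelief (63/10) (63/10) (111/20) (1/100) (3/5000) → CoreOffTubeFloor (63/10) (63/10) (111/20) (1/100) (1/1000) →
AnnularPhaseFloor (63/10) (24/5) (63/10) (1/1000) → PolyTextureFloor (63/10) (24/5) (1/1000) → AnnularDefectFloor (24/5) (63/10) → DefectiveCollarFloor (24/5) → StrainedPatchRec`. -/
theorem strainedPatchRec_of_homFloor_milli_of_tailPenalty_of_coreRelief_of_coreOff_555_of_annularPhase_of_poly_of_annular_of_near
    (hH : HomFloor (1 / 1000)) (hT : TailPenalty (111 / 20) (1 / 10000)) (hR : CoreCoreRelief (63 / 10) (63 / 10) (111 / 20) (1 / 100) (3 / 5000))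
    (hC : CoreOffTubeFloor (63 / 10) (63 / 10) (111 / 20) (1 / 100) (1 / 1000)) (hF : AnnularPhaseFloor (63 / 10) (24 / 5) (63 / 10) (1 / 1000))
    (hP : PolyTextureFloor (63 / 10) (24 / 5) (1 / 1000)) (hA : AnnularDefectFloor (24 / 5) (63 / 10)) (hD : DefectiveCollarFloor (24 / 5)) :
    StrainedPatchRec :=
  strainedPatchRec_of_homFloor_of_tailPenalty_of_coreRelief_of_coreOff_of_annularPhase_of_poly_of_annular_of_near (by norm_num) hH hT hR
    seam_arith_core_milli hC hF hP (by norm_num) (by norm_num) (by norm_num) hA hD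

/-- ★★ … and as the `h1` hypothesis of `…CollarCensusZeroFree.aperiodicFrustratedLawGap_of_collarPiecesKK_milli_unionT_zero_free`. -/
theorem strainedPatch_of_homFloor_milli_of_tailPenalty_of_coreRelief_of_coreOff_555_of_annularPhase_of_poly_of_annular_of_near
    (hH : HomFloor (1 / 1000)) (hT : TailPenalty (111 / 20) (1 / 10000)) (hR : CoreCoreRelief (63 / 10) (63 / 10) (111 / 20) (1 / 100) (3 / 5000))
    (hC : CoreOffTubeFloor (63 / 10) (63 / 10) (111 / 20) (1 / 100) (1 / 1000)) (hF : AnnularPhaseFloor (63 / 10) (24 / 5) (63 / 10) (1 / 1000))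
    (hP : PolyTextureFloor (63 / 10) (24 / 5) (1 / 1000)) (hA : AnnularDefectFloor (24 / 5) (63 / 10)) (hD : DefectiveCollarFloor (24 / 5)) :
    StrainedPatchMotifPricingCapXK (1 / 1000) (9 / 5) (133 / 10) (3 / 2) (effPot w₄₅ ω₄ (3 / 400)) (-(7175 / 10000) + 3 / 400)
      (Collar (9 / 2) fun N y j => (∃ s : ℝ, 0 ≤ s ∧ s ≤ 3 / 2 ∧ NonEquilibriumCore (-(7175 / 10000)) 0 7 s (1 / 10000) N y j) ∨
        GoodAtScale (1 / 20) (3 / 2) y j) :=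
  strainedPatch_iff.1
    (strainedPatchRec_of_homFloor_milli_of_tailPenalty_of_coreRelief_of_coreOff_555_of_annularPhase_of_poly_of_annular_of_near hH hT hR hC hF hP hA hD)

/-- The milli variant's residual implies the record one (core-radius ladder), so nothing typed at `24/5` is lost. [formal bookkeeping] -/
theorem coreOff_record_of_coreOff_555 (h : CoreOffTubeFloor (63 / 10) (63 / 10) (111 / 20) (1 / 100) (1 / 1000)) :
    CoreOffTubeFloor (63 / 10) (63 / 10) (24 / 5) (1 / 100) (1 / 1000) :=
  h.of_le_core (by norm_num)

end Summit.AtomisticToContinuum.Crystallization.Theorems.FrustratedLawDichotomyStrainedPatchCoreTubeMilli
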